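import Summits.QuantumAdvantage.AdviceFreeQNC0.FibreDecimation37LabelFourier
import Summits.QuantumAdvantage.AdviceFreeQNC0.FibreDecimation37ParityCount
import HarnessLib

/-!
# Cell qa-qnc0, `p = 3` — ROUND-37P2 §3.8 (ii), File E: STEP 3′ on a parity class WITH A LABEL FACTOR (an arbitrary Boolean
# function of `R` label forms), Parseval on `𝔽₃^J × 𝔽₃^R`

Planner qa-qnc0-p2 g37, ROUND-37P2 §3.8 (ii) ("expand only the fibre parity; the seeded factor `(−1)^G` is bounded by Parseval on the
label group `𝔽₃^R`; cross terms are single characters; hypothesis (NH/S)").  The count of `FibreDecimation37ParityCount.lean` with the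
extra factor `(−1)^{[g(L(u))]}`, `L(u) = (⟨S_i,u⟩)_{i<R}`, `g` ARBITRARY:

* `labelSign`, `norm_twisted_label_sum_le` — `‖Σ_u (−1)^{#fire(u)}(−1)^{[g(L u)]}χ₂(t)^{|u|}‖ ≤ 2^{|ι|}([t=0]/3 + 5/24)` under
  `Σ_{(s,γ)≠0, supp s ⊆ J}(3/4)^{wt(λ(s)+Λ(γ))} ≤ 1/50` (coefficients `c_{s,γ} = ∏_k|a_{k,s_k}|·|ĝ_γ|`, `Σ c² = 1·1` by the two
  Parsevals, zero pattern `≤ 1/3` / `0`, Cauchy–Schwarz);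
* **`card_parityClass_filter_label_le`** — on `{u : |u| ≡ p}` the parity of `#fire(u) + [g(L(u))]` is prescribed on `≤ (7/8)·2^{|ι|−1}` points.

The cell's statement (planner p2 g37 §3.8 (ii)); not in print.  WHAT THIS IS NOT: nothing about the game; the fibre assembly is the sequel.
-/

noncomputable section

namespace Summit.QuantumAdvantage.AdviceFreeQNC0.Exp37

open Finset ZMod
open Literature.Computability.MetaComplexity Literature.Computability.MetaComplexity.ModTestProduct
open Literature.Computability.MetaComplexity.TwoModuli

section LabelCount

variable {ι : Type*} [Fintype ι] [DecidableEq ι] {κ : Type*} [Fintype κ] [DecidableEq κ]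

/-- The `±1`-valued label factor `(−1)^{[g(v)]}`. -/
def labelSign {R : ℕ} (g : (Fin R → ZMod 3) → Bool) (v : Fin R → ZMod 3) : ℂ := if g v then -1 else 1

omit [Fintype ι] [DecidableEq ι] [Fintype κ] [DecidableEq κ] in
/-- The label factor is a sign. -/
theorem labelSign_sign {R : ℕ} (g : (Fin R → ZMod 3) → Bool) (v : Fin R → ZMod 3) :
    labelSign g v = 1 ∨ labelSign g v = -1 := by
  unfold labelSign; split_ifs <;> simp

/-- **The bound on the twisted sums with a label factor.**  Trivial tests off `J`, a genuine test `k₀`, an ARBITRARY Boolean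
function `g` of `R` label forms `S`, and the (NH/S) sum `≤ 1/50`:
`‖Σ_u (−1)^{#fire(u)}(−1)^{[g(L(u))]} χ₂(t)^{|u|}‖ ≤ 2^{|ι|}·([t = 0]/3 + 5/24)`. -/
theorem norm_twisted_label_sum_le {R : ℕ} (δ : κ → ι → ZMod 3) (A : κ → Finset (ZMod 3)) (J : Finset κ)
    (hJ : ∀ k, k ∉ J → A k = ∅) (k₀ : κ) (hk₀ : (A k₀).Nonempty) (hk₀' : A k₀ ≠ univ)
    (S : Fin R → ι → ZMod 3) (g : (Fin R → ZMod 3) → Bool)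
    (hι : 0 < Fintype.card ι)
    (hW : ∑ sγ ∈ univ.filter (fun sγ : (κ → ZMod 3) × (Fin R → ZMod 3) => sγ ≠ 0 ∧ ∀ k, k ∉ J → sγ.1 k = 0),
      ((3 : ℝ) / 4) ^ wt (combo δ sγ.1 + combo S sγ.2) ≤ 1 / 50)
    (t : ZMod 2) :
    ‖∑ u : ι → Bool, (-1 : ℂ) ^ (univ.filter fun k => subsetSum (δ k) u ∈ A k).card *
        labelSign g (fun i => subsetSum (S i) u) *
        (stdAddChar t : ℂ) ^ (univ.filter fun i => u i = true).card‖
      ≤ (2 : ℝ) ^ Fintype.card ι * ((if t = 0 then (1 : ℝ) / 3 else 0) + 5 / 24) := by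
  classical
  set a : κ → ZMod 3 → ℂ := fun k => fcoef (signTest (A k)) with ha
  set b : (Fin R → ZMod 3) → ℂ := lcoef (labelSign g) with hb
  have hmain := norm_sum_prod_label_twist_le δ a (fun k => signTest (A k)) (fun k v => fourier_inversion _ v)
    S b (labelSign g) (label_inversion _) t
  simp_rw [prod_signTest_eq] at hmain
  refine hmain.trans ?_
  -- abbreviations
  set c : (κ → ZMod 3) × (Fin R → ZMod 3) → ℝ := fun sγ => (∏ k, ‖a k (sγ.1 k)‖) * ‖b sγ.2‖ with hc
  set S' : Finset ((κ → ZMod 3) × (Fin R → ZMod 3)) :=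
    univ.filter (fun sγ : (κ → ZMod 3) × (Fin R → ZMod 3) => sγ ≠ 0 ∧ ∀ k, k ∉ J → sγ.1 k = 0) with hS'
  have hc_nonneg : ∀ s, 0 ≤ c s := fun s => mul_nonneg (prod_nonneg fun k _ => norm_nonneg _) (norm_nonneg _)
  -- patterns touching a trivial test contribute nothing
  have hc_zero : ∀ s : (κ → ZMod 3) × (Fin R → ZMod 3), s ≠ 0 → s ∉ S' → c s = 0 := by
    intro s hs0 hs
    have : ¬ ∀ k, k ∉ J → s.1 k = 0 := fun h => hs (mem_filter.2 ⟨mem_univ _, hs0, h⟩)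
    push Not at this
    obtain ⟨k, hkJ, hsk⟩ := this
    rw [hc]; dsimp only
    rw [prod_eq_zero (mem_univ k) (by rw [ha]; dsimp only; rw [hJ k hkJ, fcoef_signTest_empty hsk, norm_zero]), zero_mul]
  -- the zero pattern: `c 0 ≤ 1/3`
  have hc0 : c 0 ≤ 1 / 3 := by
    rw [hc]; dsimp only
    rw [Prod.fst_zero, Prod.snd_zero, ← mul_prod_erase univ _ (mem_univ k₀)]
    have h1 : ‖a k₀ ((0 : κ → ZMod 3) k₀)‖ = 1 / 3 := by
      rw [ha]; exact fcoef_sign_norm_zero _ (signTest_sign' _) (signTest_nonconst' hk₀ hk₀')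
    rw [h1]
    have h2 : ∏ k ∈ univ.erase k₀, ‖a k ((0 : κ → ZMod 3) k)‖ ≤ 1 := by
      calc ∏ k ∈ univ.erase k₀, ‖a k ((0 : κ → ZMod 3) k)‖ ≤ ∏ k ∈ univ.erase k₀, (1 : ℝ) :=
            prod_le_prod (fun k _ => norm_nonneg _) fun k _ => norm_fcoef_signTest_le_one _ _
        _ = 1 := prod_const_one
    have h3 : ‖b 0‖ ≤ 1 := by rw [hb]; exact norm_lcoef_le_one _ (labelSign_sign g) _
    have h23 := mul_le_mul h2 h3 (norm_nonneg _) (by norm_num)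
    have : 0 ≤ (∏ k ∈ univ.erase k₀, ‖a k ((0 : κ → ZMod 3) k)‖) * ‖b 0‖ :=
      mul_nonneg (prod_nonneg fun k _ => norm_nonneg _) (norm_nonneg _)
    nlinarith
  -- Parseval over all patterns: `Σ c² = (Σ_s ∏‖a‖²)(Σ_γ ‖b‖²) = 1`
  have hpars : ∑ s : (κ → ZMod 3) × (Fin R → ZMod 3), c s ^ 2 = 1 := by
    have e : ∀ s : (κ → ZMod 3) × (Fin R → ZMod 3), c s ^ 2 = (∏ k, ‖a k (s.1 k)‖ ^ 2) * ‖b s.2‖ ^ 2 := fun s => by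
      rw [hc]; dsimp only; rw [mul_pow, prod_pow]
    simp_rw [e]
    rw [Fintype.sum_prod_type]
    dsimp only
    rw [← Finset.sum_mul_sum, ← Fintype.prod_sum (fun k tk => ‖a k tk‖ ^ 2),
      prod_eq_one fun k _ => sum_norm_sq_fcoef_signTest (A k), one_mul, hb]
    exact sum_norm_sq_lcoef _ (labelSign_sign g)
  -- Cauchy–Schwarz on the non-zero patterns supported on `J`
  set X : ℝ := ∑ s ∈ S', c s * (Real.sqrt 3 / 2) ^ wt (combo δ s.1 + combo S s.2) with hX
  have hX_nonneg : 0 ≤ X := sum_nonneg fun s _ => mul_nonneg (hc_nonneg s) (by positivity)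
  have hXle : X ≤ 5 / 24 := by
    have hcs := sum_mul_sq_le_sq_mul_sq S' c (fun s => (Real.sqrt 3 / 2) ^ wt (combo δ s.1 + combo S s.2))
    have h1 : ∑ s ∈ S', c s ^ 2 ≤ 1 := by
      rw [← hpars]
      exact sum_le_sum_of_subset_of_nonneg (filter_subset _ _) fun s _ _ => sq_nonneg _
    have h2 : ∑ s ∈ S', ((Real.sqrt 3 / 2) ^ wt (combo δ s.1 + combo S s.2)) ^ 2 ≤ 1 / 50 := by
      refine le_trans (le_of_eq (sum_congr rfl fun s _ => ?_)) hW
      rw [← pow_mul, mul_comm, pow_mul, div_pow, Real.sq_sqrt (by norm_num : (0 : ℝ) ≤ 3)]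
      norm_num
    have hsq : X ^ 2 ≤ 1 * (1 / 50) :=
      hcs.trans (mul_le_mul h1 h2 (sum_nonneg fun s _ => sq_nonneg _) (by norm_num))
    nlinarith [hX_nonneg, hsq]
  -- assemble: split the sum over patterns into `0`, `S'`, and the rest (which vanishes)
  have hsplit : ∑ s : (κ → ZMod 3) × (Fin R → ZMod 3),
      c s * ∏ i, ‖(1 : ℂ) + stdAddChar (combo δ s.1 i + combo S s.2 i) * stdAddChar t‖
      = c 0 * ∏ i, ‖(1 : ℂ) + stdAddChar (combo δ (0 : (κ → ZMod 3) × (Fin R → ZMod 3)).1 i +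
          combo S (0 : (κ → ZMod 3) × (Fin R → ZMod 3)).2 i) * stdAddChar t‖ +
        ∑ s ∈ S', c s * ∏ i, ‖(1 : ℂ) + stdAddChar (combo δ s.1 i + combo S s.2 i) * stdAddChar t‖ := by
    rw [← sum_erase_add _ _ (mem_univ (0 : (κ → ZMod 3) × (Fin R → ZMod 3))), add_comm]
    congr 1
    symm
    refine sum_subset (fun s hs => mem_erase.2 ⟨(mem_filter.1 hs).2.1, mem_univ _⟩) fun s hs hs' => ?_
    rw [hc_zero s (ne_of_mem_erase hs) hs', zero_mul]
  have hcombo0 : ∀ i, combo δ (0 : (κ → ZMod 3) × (Fin R → ZMod 3)).1 i +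
      combo S (0 : (κ → ZMod 3) × (Fin R → ZMod 3)).2 i = 0 := by
    intro i; unfold combo; simp
  rw [show (∑ s : (κ → ZMod 3) × (Fin R → ZMod 3), ((∏ k, ‖a k (s.1 k)‖) * ‖b s.2‖) *
        ∏ i, ‖(1 : ℂ) + stdAddChar (combo δ s.1 i + combo S s.2 i) * stdAddChar t‖)
      = ∑ s : (κ → ZMod 3) × (Fin R → ZMod 3),
        c s * ∏ i, ‖(1 : ℂ) + stdAddChar (combo δ s.1 i + combo S s.2 i) * stdAddChar t‖ from rfl, hsplit]
  simp only [hcombo0]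
  -- the `S'` part
  have hS'le : ∑ s ∈ S', c s * ∏ i, ‖(1 : ℂ) + stdAddChar (combo δ s.1 i + combo S s.2 i) * stdAddChar t‖
      ≤ (2 : ℝ) ^ Fintype.card ι * X := by
    rw [hX, mul_sum]
    refine sum_le_sum fun s _ => ?_
    have hp := prod_norm_twist_le (combo δ s.1 + combo S s.2) t
    simp only [Pi.add_apply] at hp
    calc c s * ∏ i, ‖(1 : ℂ) + stdAddChar (combo δ s.1 i + combo S s.2 i) * stdAddChar t‖
        ≤ c s * ((2 : ℝ) ^ Fintype.card ι * (Real.sqrt 3 / 2) ^ wt (combo δ s.1 + combo S s.2)) :=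
          mul_le_mul_of_nonneg_left hp (hc_nonneg s)
      _ = _ := by ring
  -- the zero pattern
  have h0le : c 0 * ∏ _i : ι, ‖(1 : ℂ) + stdAddChar (0 : ZMod 3) * stdAddChar t‖
      ≤ (2 : ℝ) ^ Fintype.card ι * (if t = 0 then (1 : ℝ) / 3 else 0) := by
    by_cases ht : t = 0
    · rw [if_pos ht, ht]
      have hprod : ∏ _i : ι, ‖(1 : ℂ) + stdAddChar (0 : ZMod 3) * stdAddChar (0 : ZMod 2)‖
          = (2 : ℝ) ^ Fintype.card ι := by
        simp only [AddChar.map_zero_eq_one, mul_one]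
        rw [prod_const, card_univ]; norm_num
      rw [hprod, mul_comm]
      exact mul_le_mul_of_nonneg_left hc0 (by positivity)
    · rw [if_neg ht]
      have ht01 : ∀ t' : ZMod 2, t' = 0 ∨ t' = 1 := by decide
      have ht1 : t = 1 := by
        rcases ht01 t with h | h
        · exact absurd h ht
        · exact h
      rw [ht1]
      rw [prod_norm_twist_zero hι]; simp
  calc c 0 * ∏ _i : ι, ‖(1 : ℂ) + stdAddChar (0 : ZMod 3) * stdAddChar t‖ +
        ∑ s ∈ S', c s * ∏ i, ‖(1 : ℂ) + stdAddChar (combo δ s.1 i + combo S s.2 i) * stdAddChar t‖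
      ≤ (2 : ℝ) ^ Fintype.card ι * (if t = 0 then (1 : ℝ) / 3 else 0) + (2 : ℝ) ^ Fintype.card ι * X :=
        add_le_add h0le hS'le
    _ ≤ (2 : ℝ) ^ Fintype.card ι * ((if t = 0 then (1 : ℝ) / 3 else 0) + 5 / 24) := by
        rw [mul_add]
        exact add_le_add le_rfl (mul_le_mul_of_nonneg_left hXle (by positivity))

/-- **STEP 3′ with a label factor (ROUND-37P2 §3.8 (ii)).**  Tests as in `card_parityClass_filter_le` plus an arbitrary Boolean
function `g` of `R` label forms; if the (NH/S) sum over the pairs `(s, γ) ≠ 0` with `supp s ⊆ J` is `≤ 1/50`, then on the parity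
class `{u : |u| ≡ p}` the parity of `#fire(u) + [g(L(u))]` is prescribed on at most `(7/8)·2^{|ι|−1}` points. -/
theorem card_parityClass_filter_label_le {R : ℕ} (δ : κ → ι → ZMod 3) (A : κ → Finset (ZMod 3)) (J : Finset κ)
    (hJ : ∀ k, k ∉ J → A k = ∅) (k₀ : κ) (hk₀ : (A k₀).Nonempty) (hk₀' : A k₀ ≠ univ)
    (S : Fin R → ι → ZMod 3) (g : (Fin R → ZMod 3) → Bool)
    (hι : 0 < Fintype.card ι)
    (hW : ∑ sγ ∈ univ.filter (fun sγ : (κ → ZMod 3) × (Fin R → ZMod 3) => sγ ≠ 0 ∧ ∀ k, k ∉ J → sγ.1 k = 0),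
      ((3 : ℝ) / 4) ^ wt (combo δ sγ.1 + combo S sγ.2) ≤ 1 / 50)
    (p c : ℕ) :
    ((univ.filter fun u : ι → Bool =>
        (univ.filter fun i => u i = true).card % 2 = p % 2 ∧
        ((univ.filter fun k => subsetSum (δ k) u ∈ A k).card +
          (if g (fun i => subsetSum (S i) u) then 1 else 0)) % 2 = c % 2).card : ℝ)
      ≤ 7 / 8 * (2 : ℝ) ^ (Fintype.card ι - 1) := by
  classical
  -- notation
  set wtu : (ι → Bool) → ℕ := fun u => (univ.filter fun i => u i = true).card with hwtu
  set N : (ι → Bool) → ℕ := fun u => (univ.filter fun k => subsetSum (δ k) u ∈ A k).card +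
    (if g (fun i => subsetSum (S i) u) then 1 else 0) with hN
  set E : Finset (ι → Bool) := univ.filter fun u => wtu u % 2 = p % 2 with hE
  -- the signed count on the class
  set R' : ℝ := ∑ u ∈ E, (-1 : ℝ) ^ N u with hR
  -- (1) `2R = T₀ + (−1)^p T₁` and the norm bounds
  have hF : ∀ u : ι → Bool, (-1 : ℂ) ^ N u =
      (-1 : ℂ) ^ (univ.filter fun k => subsetSum (δ k) u ∈ A k).card * labelSign g (fun i => subsetSum (S i) u) := by
    intro u
    rw [hN]; dsimp only
    rw [pow_add]
    unfold labelSign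
    split_ifs <;> simp
  have hT : ∀ t : ZMod 2, ‖∑ u : ι → Bool, (-1 : ℂ) ^ N u * (stdAddChar t : ℂ) ^ wtu u‖
      ≤ (2 : ℝ) ^ Fintype.card ι * ((if t = 0 then (1 : ℝ) / 3 else 0) + 5 / 24) := by
    intro t
    have h := norm_twisted_label_sum_le δ A J hJ k₀ hk₀ hk₀' S g hι hW t
    simp_rw [hF]
    exact h
  have hRC : ((R' : ℝ) : ℂ) = ∑ u ∈ E, (-1 : ℂ) ^ N u := by
    rw [hR]; push_cast; rfl
  have hRid : (∑ u : ι → Bool, (-1 : ℂ) ^ N u * (stdAddChar (0 : ZMod 2) : ℂ) ^ wtu u) +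
      (-1 : ℂ) ^ p * (∑ u : ι → Bool, (-1 : ℂ) ^ N u * (stdAddChar (1 : ZMod 2) : ℂ) ^ wtu u) =
      2 * ∑ u ∈ E, (-1 : ℂ) ^ N u := by
    rw [AddChar.map_zero_eq_one, stdAddChar_two_one, mul_sum, ← sum_add_distrib,
      ← sum_filter_add_sum_filter_not univ (fun u : ι → Bool => wtu u % 2 = p % 2)]
    have hon : ∀ u ∈ univ.filter (fun u : ι → Bool => wtu u % 2 = p % 2),
        (-1 : ℂ) ^ N u * (1 : ℂ) ^ wtu u + (-1 : ℂ) ^ p * ((-1 : ℂ) ^ N u * (-1 : ℂ) ^ wtu u) =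
          2 * (-1 : ℂ) ^ N u := by
      intro u hu
      have h := (mem_filter.1 hu).2
      have hsgn := neg_one_pow_mul_neg_one_pow p (wtu u)
      rw [if_pos (by omega)] at hsgn
      have hsgnC : ((-1 : ℂ) ^ p) * (-1) ^ wtu u = 1 := by exact_mod_cast hsgn
      rw [one_pow]
      linear_combination ((-1 : ℂ) ^ N u) * hsgnC
    have hoff : ∀ u ∈ univ.filter (fun u : ι → Bool => ¬ wtu u % 2 = p % 2),
        (-1 : ℂ) ^ N u * (1 : ℂ) ^ wtu u + (-1 : ℂ) ^ p * ((-1 : ℂ) ^ N u * (-1 : ℂ) ^ wtu u) = 0 := by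
      intro u hu
      have h := (mem_filter.1 hu).2
      have hsgn := neg_one_pow_mul_neg_one_pow p (wtu u)
      rw [if_neg (by omega)] at hsgn
      have hsgnC : ((-1 : ℂ) ^ p) * (-1) ^ wtu u = -1 := by exact_mod_cast hsgn
      rw [one_pow]
      linear_combination ((-1 : ℂ) ^ N u) * hsgnC
    rw [sum_congr rfl hon, sum_congr rfl hoff, sum_const_zero, add_zero, ← mul_sum]
  have hRabs : 2 * |R'| ≤ (2 : ℝ) ^ Fintype.card ι * (3 / 4) := by
    have h : ‖(2 : ℂ) * ((R' : ℝ) : ℂ)‖ = ‖(∑ u : ι → Bool, (-1 : ℂ) ^ N u * (stdAddChar (0 : ZMod 2) : ℂ) ^ wtu u) +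
        (-1 : ℂ) ^ p * (∑ u : ι → Bool, (-1 : ℂ) ^ N u * (stdAddChar (1 : ZMod 2) : ℂ) ^ wtu u)‖ := by
      rw [hRid, hRC]
    rw [norm_mul, Complex.norm_real, Real.norm_eq_abs] at h
    have h2 : ‖(2 : ℂ)‖ = 2 := by simp
    rw [h2] at h
    rw [h]
    refine (norm_add_le _ _).trans ?_
    rw [norm_mul]
    have hp1 : ‖(-1 : ℂ) ^ p‖ = 1 := by simp
    rw [hp1, one_mul]
    have h0 := hT 0
    have h1 := hT 1
    rw [if_pos rfl] at h0
    rw [if_neg (by decide)] at h1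
    linarith
  -- (2) the class has `2^{|ι|−1}` points, split by the parity of `N`
  have hEcard : (E.card : ℝ) = (2 : ℝ) ^ (Fintype.card ι - 1) := card_parityClass hι p
  have hsplit := card_filter_add_card_filter_not (s := E) (fun u => N u % 2 = 0)
  have hpos : ∀ u ∈ E.filter (fun u => N u % 2 = 0), (-1 : ℝ) ^ N u = 1 :=
    fun u hu => (Nat.even_iff.2 (mem_filter.1 hu).2).neg_one_pow
  have hneg : ∀ u ∈ E.filter (fun u => ¬ N u % 2 = 0), (-1 : ℝ) ^ N u = -1 :=
    fun u hu => (Nat.odd_iff.2 (by have := (mem_filter.1 hu).2; omega)).neg_one_pow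
  have hRsplit : R' = ((E.filter fun u => N u % 2 = 0).card : ℝ) - ((E.filter fun u => ¬ N u % 2 = 0).card : ℝ) := by
    rw [hR, ← sum_filter_add_sum_filter_not E (fun u => N u % 2 = 0), sum_congr rfl hpos, sum_congr rfl hneg]
    simp [sub_eq_add_neg]
  have hpow : (2 : ℝ) ^ Fintype.card ι = 2 * (2 : ℝ) ^ (Fintype.card ι - 1) := by
    rw [← pow_succ']; congr 1; omega
  -- (3) the target set is one of the two parts
  have htarget : (univ.filter fun u : ι → Bool => wtu u % 2 = p % 2 ∧ N u % 2 = c % 2) =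
      E.filter fun u => N u % 2 = c % 2 := by
    rw [hE, filter_filter]
  rw [htarget]
  have hsplitR : ((E.filter fun u => N u % 2 = 0).card : ℝ) + ((E.filter fun u => ¬ N u % 2 = 0).card : ℝ)
      = E.card := by exact_mod_cast hsplit
  rcases Nat.mod_two_eq_zero_or_one c with hc | hc
  · rw [hc]
    have habs := le_abs_self R'
    linarith
  · rw [hc]
    have e : (E.filter fun u => N u % 2 = 1) = E.filter fun u => ¬ N u % 2 = 0 :=
      filter_congr fun u _ => by omega
    rw [e]
    have habs := neg_abs_le R'
    linarith


end LabelCount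

end Summit.QuantumAdvantage.AdviceFreeQNC0.Exp37

end
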